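import Mathlib
import HarnessLib

/-!
# Venture HSemireg — the four-level transversal level law: every level block of `[[η,x²],y]` is tangent

HONEST FRAMING. Lean leaf for the computation cell `pub-hsemireg` (target seat t-5 gen 20; file of record
`run/shared/lean/pub/pub-hsemireg/target-g6/EXP-PENCILS-t5g20.md` §7). Setting of the fibre test for reduced-point
complexes (TH3-SIGMA-ORBIT-PROOF §1) at FOUR levels: `x = u(s)` a pencil element (odd, degree `+1`), `y, y'` conormal
vectors at `x` (odd, degree `-1`, `xy = -yx`, `xy' = -y'x`), `η ∈ 𝔤` any even operator (e.g. a gauge element of the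
orbit lemma, `u_t = [η,x]`, so that the curvature is `{x,u_t} = [η,x²]`), all in `R = End(M)`; `τ` is the trace of
`End(M)` and `g` a level projection `π_q` (or any polynomial in the level operator `h`).

THE LAW (t-5 g20, EXP-PENCILS §7, «THEOREM B»): **at four levels, for every `q`, `tr(π_q · [[η,x²],y] · y') = 0`** —
every level block of the degree-`+1` operator `[[η,x²],y]` is orthogonal to `N*_x`, i.e. tangent to the orbit of `x`.
With t-5 g20's reduction (EXP-PENCILS §2.2: for an (E1)-class, `[x, B(s×t)] = [x²,V_t] = ∓[x,{u_t,y}] = ∓[{x,u_t},y]`,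
`y = V(s)`) this is **t-5 g17's levelwise law (LL) for every TRANSVERSAL component of every (E1)-class at four levels**
(«THEOREM A»); both fail at five levels (exp-pencil census), in accordance with the four-level vanishing lemma
(`FibreTestFourLevelVanishing`) on which the proof rests.

PROOF ENCODED HERE: expand `g·[[η,x²],y]·y'` into four words; after one cyclic rotation under the trace each contains
one of the vanishing words `y x x y'`, `y y' x x`, `x x y' y`, `y' y x x` of the four-level vanishing lemma. The level
bookkeeping of the rotation is abstracted into three commutation hypotheses of the level projection `g = π_q` with
`x²`, `y`, `y'`: `π_q x² = x² π_{q-2}`, `π_q y = y π_{q+1}`, `y' π_q = π_{q-1} y'` (the shifted projections appear as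
`g₁, g₂, g₃`); `τ` is any additive map with `τ(ab) = τ(ba)`. Nothing here constructs an object or bears on HC, HC_CM
or HC_AV; the vanishing words are hypotheses here (they are the conclusions of `FibreTestFourLevelVanishing`).
-/

namespace Summit.Ventures.HSemireg

/-- **Four-level transversal level law** (t-5 g20, EXP-PENCILS §7 THEOREM B; any ring, any trace-like `τ`).
Hypotheses: `x x y = y (x x)` (from `xy = -yx`); the four-level vanishing words `y x x y' = 0`, `y y' x x = 0`,
`x x y' y = 0`, `y' y x x = 0`; the level-projection commutations `g (x x) = (x x) g₁`, `g y = y g₂`, `y' g = g₃ y'`.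
Conclusion: `τ (g · ((η x² - x² η) y - y (η x² - x² η)) · y') = 0`. [folklore] -/
theorem trace_levelBlock_transversal_eq_zero {R S : Type*} [Ring R] [AddCommGroup S]
    (τ : R →+ S) (htr : ∀ a b : R, τ (a * b) = τ (b * a))
    (x y y' η g g₁ g₂ g₃ : R)
    (hx2y : x * x * y = y * (x * x))
    (H1 : y * x * x * y' = 0) (H2 : y * y' * x * x = 0) (H3 : x * x * y' * y = 0) (H4 : y' * y * x * x = 0)
    (hg1 : g * (x * x) = (x * x) * g₁) (hg2 : g * y = y * g₂) (hg3 : y' * g = g₃ * y') :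
    τ (g * ((η * (x * x) - (x * x) * η) * y - y * (η * (x * x) - (x * x) * η)) * y') = 0 := by
  -- the four words
  have hsplit : g * ((η * (x * x) - (x * x) * η) * y - y * (η * (x * x) - (x * x) * η)) * y'
      = g * η * (x * x * y) * y' - g * (x * x) * (η * y * y') - g * y * (η * (x * x) * y') + g * y * (x * x) * η * y' := by
    noncomm_ring
  -- (i)  g η x² y y' = g η (y x x y') = 0
  have h1 : g * η * (x * x * y) * y' = 0 := by
    rw [hx2y]
    calc g * η * (y * (x * x)) * y' = g * η * (y * x * x * y') := by noncomm_ring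
      _ = 0 := by rw [H1]; simp
  -- (ii) τ(g x² · η y y') = τ(η y y' · x² g₁) = τ(η (y y' x x) g₁) = 0
  have h2 : τ (g * (x * x) * (η * y * y')) = 0 := by
    rw [htr, hg1]
    calc τ (η * y * y' * (x * x * g₁)) = τ (η * (y * y' * x * x) * g₁) := by congr 1; noncomm_ring
      _ = 0 := by rw [H2]; simp
  -- (iii) τ(g y · η x² y') = τ(η x² y' · y g₂) = τ(η (x x y' y) g₂) = 0
  have h3 : τ (g * y * (η * (x * x) * y')) = 0 := by
    rw [htr, hg2]
    calc τ (η * (x * x) * y' * (y * g₂)) = τ (η * (x * x * y' * y) * g₂) := by congr 1; noncomm_ring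
      _ = 0 := by rw [H3]; simp
  -- (iv) τ(g y x² η · y') = τ(y' g · y x² η) = τ(g₃ (y' y x x) η) = 0
  have h4 : τ (g * y * (x * x) * η * y') = 0 := by
    have e4 : g * y * (x * x) * η * y' = (g * y * (x * x) * η) * y' := by noncomm_ring
    rw [e4, htr]
    calc τ (y' * (g * y * (x * x) * η)) = τ ((y' * g) * y * (x * x) * η) := by congr 1; noncomm_ring
      _ = τ ((g₃ * y') * y * (x * x) * η) := by rw [hg3]
      _ = τ (g₃ * (y' * y * x * x) * η) := by congr 1; noncomm_ring
      _ = 0 := by rw [H4]; simp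
  rw [hsplit, map_add, map_sub, map_sub, h1, h2, h3, h4]
  simp

end Summit.Ventures.HSemireg
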